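import Summits.AtomisticToContinuum.Crystallization.Theorems.FrustratedLawDichotomyBumpNearFieldB
import Mathlib.Analysis.Convex.Mul

/-!
# FrustratedLawDichotomy · ★★★ `SF₄₅` IS A THEOREM: the near-field certificate assembled

`…BumpKappaL.sf₄₅_of_nearIneq` (hand-1 g13) reduced lens-5 g34's Schur floor of record `SF₄₅ = SchurFloor w₄₅ ω₄ (3/400)` to ONE
one-variable inequality on `r ∈ (3, 109/20]`.  `…BumpNearFieldA` / `…NearFieldAb` / `…NearFieldB` (generated from exact rational data) provide a
degree-9 polynomial minorant `qpoly` of `s⁻⁵` (`≥ 0`), a degree-7 minorant `mpoly` of the inner integral `32/195 − Pbar`, the piecewise-polynomial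
value `G` of the minorised `s`-integral (kinds A/B/C) and SEVEN Bernstein positivity certificates `r·sec(r)·w(r) ≤ 6K₀·G(r)` on sub-pieces of
`(3, 109/20]` (`sec` = secant of `r⁻⁶`, an upper bound by convexity; the `r⁻¹²/12` term of `−V` is dropped).  THIS FILE does the analysis that connects them:

* §1 `w₄₅` on `[3, 9/2]` is the cubic `3x² − 2x³`, `x = (r − 3)/(3/2)`;
* §2 for `r ∈ (3, 109/20]`: the `s`-integrand `s·kappaL(s)·∫_{|r−s|}^{r+s} τ·omega₂(5τ/4) dτ` is nonnegative, continuous, supported in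
  `s ≤ r + 8/5`, hence integrable on `(0, ∞)`; on the window it equals `(6M)⁻¹·s⁻⁵·ramp(s)·(32/195 − Pbar|r − s|)` and dominates
  `(6M)⁻¹·qpoly(s)·ramp(s)·(32/195 − Pbar|r − s|)`; the latter integrates to `(6M)⁻¹·(G₁ + G₂ + G₃)(r)` (three sub-pieces per kind A/B/C);
* §3 `−(V·w₄₅)(r) ≤ sec(r)·w₄₅(r)/6` (drop `r⁻¹²/12`, `r⁻⁶ ≤` secant by `convexOn_zpow (−6)`), the constant identity
  `(4/5)³·(512π/3465)·2π·(6M)⁻¹ = 6K₀/6` with `K₀ = (11025/20790)/(4/5)³` (`π` cancels), and the seven certificates give the near-field inequality;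
  ★★★ `sf₄₅_holds : SF₄₅`.

So the Schur tail floor beneath the residual of record `T′♭₄₅` of column 27623 is PROVED (0 sorry, standard axioms): the energetic feed of
`AperiodicFrustratedLawGap` is now `MuEquilibriumDoor` (proved) ∧ `UP` (tree, computational) ∧ `SF₄₅` (THIS FILE) ∧ the finite motif-certificate
families (the declared residual).  [folklore]; 0 sorry.  Prover hand 1, gen 13 (decomp-a2c), `--supports stmt-AtomisticToContinuum-27623`.
-/

noncomputable section

namespace Summit.AtomisticToContinuum.Crystallization.Theorems.FrustratedLawDichotomyBumpAutocorrelation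

open MeasureTheory Set Real
open scoped BigOperators
open Literature.MathematicalPhysics.StatisticalMechanics (lennardJones)
open Summit.AtomisticToContinuum.Crystallization.Theorems.FrustratedLawDichotomySchurCut
  (omega₂ omega₂_of_two_le SchurFloor tailPot SF₄₅ w₄₅ ω₄ cutWeight smoothstep₁ w₄₅_eq_one)

/-! ## §1. The tail weight on the window -/

/-- On `[3, 9/2]`: `w₄₅ r = 3x² − 2x³`, `x = (r − 3)/(3/2)`. [folklore] -/
theorem w₄₅_eq_cubic {r : ℝ} (h1 : 3 ≤ r) (h2 : r ≤ 9 / 2) :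
    w₄₅ r = 3 * ((r - 3) / (3 / 2)) ^ 2 - 2 * ((r - 3) / (3 / 2)) ^ 3 := by
  unfold w₄₅ cutWeight smoothstep₁
  rw [show (9 / 2 : ℝ) - 3 = 3 / 2 by norm_num]
  have hx0 : 0 ≤ (r - 3) / (3 / 2) := by positivity
  have hx1 : (r - 3) / (3 / 2) ≤ 1 := by rw [div_le_one (by norm_num)]; linarith
  split_ifs with ha hb
  · have : (r - 3) / (3 / 2) = 0 := le_antisymm ha hx0
    rw [this]; norm_num
  · have : (r - 3) / (3 / 2) = 1 := le_antisymm hx1 hb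
    rw [this]; norm_num
  · rfl

/-! ## §2. The `s`-integrand: closed form, sign, integrability, minorisation -/

/-- The inner integral in closed form for `|r − s| ≤ 8/5 ≤ r + s`. [folklore] -/
theorem inner_eq {r s : ℝ} (h1 : |r - s| ≤ 8 / 5) (h2 : 8 / 5 ≤ r + s) :
    ∫ τ in |r - s|..(r + s), τ * omega₂ (τ / (4 / 5)) = 32 / 195 - Pbar |r - s| :=
  inner_integral_eq h1 h2

/-- The inner integral vanishes for `8/5 ≤ |r − s| ≤ r + s`. [folklore] -/
theorem inner_eq_zero {r s : ℝ} (h : 8 / 5 ≤ |r - s|) (hle : |r - s| ≤ r + s) :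
    ∫ τ in |r - s|..(r + s), τ * omega₂ (τ / (4 / 5)) = 0 := by
  rw [intervalIntegral.integral_congr (g := fun _ => (0:ℝ)) (fun τ hτ => by
    rw [uIcc_of_le hle] at hτ
    simp [omega₂_of_two_le (show (2:ℝ) ≤ τ / (4 / 5) by rw [le_div_iff₀ (by norm_num : (0:ℝ) < 4/5)]; linarith [hτ.1])])]
  simp

/-- The inner integral is nonnegative when `|r − s| ≤ r + s`. [folklore] -/
theorem inner_nonneg {r s : ℝ} (h : |r - s| ≤ r + s) : 0 ≤ ∫ τ in |r - s|..(r + s), τ * omega₂ (τ / (4 / 5)) :=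
  intervalIntegral.integral_nonneg h fun τ hτ =>
    mul_nonneg ((abs_nonneg _).trans hτ.1) (omega₂_nonneg (div_nonneg ((abs_nonneg _).trans hτ.1) (by norm_num)))

/-- The inner integral as a function of `s` is continuous. [folklore] -/
theorem continuous_inner (r : ℝ) : Continuous fun s : ℝ => ∫ τ in |r - s|..(r + s), τ * omega₂ (τ / (4 / 5)) := by
  have hg : Continuous fun τ : ℝ => τ * omega₂ (τ / (4 / 5)) := continuous_id.mul (continuous_omega₂.comp (continuous_id.div_const _))
  have hP : Continuous fun x : ℝ => ∫ τ in (0:ℝ)..x, τ * omega₂ (τ / (4 / 5)) :=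
    intervalIntegral.continuous_primitive (fun a b => hg.intervalIntegrable a b) 0
  have heq : (fun s : ℝ => ∫ τ in |r - s|..(r + s), τ * omega₂ (τ / (4 / 5))) =
      fun s => (∫ τ in (0:ℝ)..(r + s), τ * omega₂ (τ / (4 / 5))) - ∫ τ in (0:ℝ)..|r - s|, τ * omega₂ (τ / (4 / 5)) := by
    funext s
    rw [intervalIntegral.integral_interval_sub_left (hg.intervalIntegrable _ _) (hg.intervalIntegrable _ _)]
  rw [heq]
  exact (hP.comp (by fun_prop)).sub (hP.comp (continuous_abs.comp (by fun_prop)))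

/-- The full `s`-integrand. -/
def sInt (r s : ℝ) : ℝ := s * kappaL s * ∫ τ in |r - s|..(r + s), τ * omega₂ (τ / (4 / 5))

/-- `sInt r` is continuous. [folklore] -/
theorem continuous_sInt (r : ℝ) : Continuous (sInt r) := by
  unfold sInt
  exact (continuous_id.mul continuous_kappaL).mul (continuous_inner r)

/-- `sInt r s ≥ 0` for `s ≥ 0`, `r ≥ 0`. [folklore] -/
theorem sInt_nonneg {r s : ℝ} (hr : 0 ≤ r) (hs : 0 ≤ s) : 0 ≤ sInt r s := by
  unfold sInt
  refine mul_nonneg (mul_nonneg hs (kappaL_nonneg s)) (inner_nonneg ?_)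
  rw [abs_le]; constructor <;> linarith

/-- `sInt r s = 0` for `s ≥ r + 8/5` (`r ≥ 0`). [folklore] -/
theorem sInt_eq_zero {r s : ℝ} (hr : 0 ≤ r) (hs : r + 8 / 5 ≤ s) : sInt r s = 0 := by
  unfold sInt
  have habs : |r - s| = s - r := by rw [abs_sub_comm, abs_of_nonneg (by linarith)]
  rw [inner_eq_zero (by rw [habs]; linarith) (by rw [habs]; linarith), mul_zero]

/-- `sInt r` is integrable on `(0, ∞)` (`r ≥ 0`). [folklore] -/
theorem integrableOn_sInt {r : ℝ} (hr : 0 ≤ r) : IntegrableOn (sInt r) (Ioi 0) :=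
  (integrableOn_Ici_of_eq_zero (continuous_sInt r) (a := 0) (fun _ hs => sInt_eq_zero hr hs)).mono_set Ioi_subset_Ici_self

/-- The minorised integrand `(6M)⁻¹·qpoly(s)·ramp(s)·mpoly(|r − s|)`. -/
def gInt (r s : ℝ) : ℝ := (6 * tailConst)⁻¹ * (qpoly s * ramp s * mpoly |r - s|)

/-- `gInt r` is continuous. [folklore] -/
theorem continuous_gInt (r : ℝ) : Continuous (gInt r) := by
  unfold gInt
  exact continuous_const.mul ((continuous_qpoly.mul continuous_ramp).mul (continuous_mpoly.comp (continuous_abs.comp (by fun_prop))))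

/-- On the window: `gInt r s ≤ sInt r s` (`0 ≤ qpoly ≤ s⁻⁵`, `ramp ≥ 0`, `mpoly ≤` inner integral `= 32/195 − Pbar|r−s| ≥ 0`). [folklore] -/
theorem gInt_le_sInt {r s : ℝ} (hs1 : 67 / 20 ≤ s) (hs2 : s ≤ 141 / 20) (hrs : |r - s| ≤ 8 / 5) (hr : 3 ≤ r) : gInt r s ≤ sInt r s := by
  have hs0 : 0 < s := by linarith
  have hin : ∫ τ in |r - s|..(r + s), τ * omega₂ (τ / (4 / 5)) = 32 / 195 - Pbar |r - s| := inner_eq hrs (by linarith)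
  have hΩ : 0 ≤ 32 / 195 - Pbar |r - s| := by linarith [Pbar_le (abs_nonneg (r - s)) hrs]
  have hm : mpoly |r - s| ≤ 32 / 195 - Pbar |r - s| := mpoly_le (abs_nonneg _) hrs
  have hκ : s * kappaL s = (6 * tailConst)⁻¹ * ((s⁻¹) ^ 5 * ramp s) := by
    rw [kappaL, max_eq_left (by linarith)]
    field_simp
  unfold gInt sInt
  rw [hin, hκ]
  have hq := qpoly_le hs1 hs2
  have hq0 := qpoly_nonneg hs1 hs2
  have hramp := (ramp_mem_Icc s).1
  have hM : 0 ≤ (6 * tailConst)⁻¹ := by have := tailConst_pos; positivity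
  have h1 : qpoly s * ramp s * mpoly |r - s| ≤ qpoly s * ramp s * (32 / 195 - Pbar |r - s|) :=
    mul_le_mul_of_nonneg_left hm (mul_nonneg hq0 hramp)
  have h2 : qpoly s * ramp s * (32 / 195 - Pbar |r - s|) ≤ (s⁻¹) ^ 5 * ramp s * (32 / 195 - Pbar |r - s|) :=
    mul_le_mul_of_nonneg_right (mul_le_mul_of_nonneg_right hq hramp) hΩ
  nlinarith [h1, h2, hM]

/-- ★ **The `s`-integral dominates the minorised window integral**: for `3 ≤ r`, `lo ≥ 67/20`, `r − 8/5 ≤ lo ≤ r + 8/5 ≤ 141/20`: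
`∫_{lo}^{r+8/5} gInt r ≤ ∫_{s>0} sInt r`. [folklore] -/
theorem window_le_integral {r lo : ℝ} (hr : 3 ≤ r) (hlo1 : 67 / 20 ≤ lo) (hlo2 : r - 8 / 5 ≤ lo) (hlo3 : lo ≤ r + 8 / 5)
    (hhi : r + 8 / 5 ≤ 141 / 20) :
    ∫ s in lo..(r + 8 / 5), gInt r s ≤ ∫ s in Ioi 0, sInt r s := by
  have hr0 : 0 ≤ r := by linarith
  have h1 : ∫ s in lo..(r + 8 / 5), gInt r s ≤ ∫ s in lo..(r + 8 / 5), sInt r s := by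
    refine intervalIntegral.integral_mono_on hlo3 ((continuous_gInt r).intervalIntegrable _ _)
      ((continuous_sInt r).intervalIntegrable _ _) fun s hs => ?_
    refine gInt_le_sInt (by linarith [hs.1]) (by linarith [hs.2]) ?_ hr
    rw [abs_le]; constructor <;> linarith [hs.1, hs.2]
  have h2 : ∫ s in lo..(r + 8 / 5), sInt r s ≤ ∫ s in Ioi 0, sInt r s := by
    rw [intervalIntegral.integral_of_le hlo3]
    refine setIntegral_mono_set (integrableOn_sInt hr0) ?_ (Filter.Eventually.of_forall fun s hs => lt_trans (show (0:ℝ) < lo by linarith) hs.1)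
    exact (ae_restrict_iff' measurableSet_Ioi).mpr (Filter.Eventually.of_forall fun s (hs : 0 < s) => sInt_nonneg hr0 hs.le)
  exact h1.trans h2

/-! ## §3. The window integral in closed form (three kinds) and the certificate -/

/-- Kind A0 (`3 < r ≤ 67/20`): `∫_{67/20}^{r+8/5} gInt r = (6M)⁻¹ (GA01 + GA02)(r)`. [folklore] -/
theorem window_A0 {r : ℝ} (h1 : 3 ≤ r) (h2 : r ≤ 67 / 20) :
    ∫ s in (67 / 20 : ℝ)..(r + 8 / 5), gInt r s = (6 * tailConst)⁻¹ * (GA01 r + GA02 r) := by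
  have hc := continuous_gInt r
  rw [← intervalIntegral.integral_add_adjacent_intervals (hc.intervalIntegrable (67 / 20) (77 / 20)) (hc.intervalIntegrable (77 / 20) (r + 8 / 5))]
  have e1 : ∫ s in (67 / 20 : ℝ)..(77 / 20), gInt r s = (6 * tailConst)⁻¹ * GA01 r := by
    rw [← integral_GA01, ← intervalIntegral.integral_const_mul]
    refine intervalIntegral.integral_congr fun s hs => ?_
    rw [uIcc_of_le (by norm_num)] at hs
    simp only [gInt]
    rw [ramp_of_mem hs.1 hs.2, abs_of_nonpos (by linarith [hs.1]), neg_sub, ← integrand_cS4]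
  have e2 : ∫ s in (77 / 20 : ℝ)..(r + 8 / 5), gInt r s = (6 * tailConst)⁻¹ * GA02 r := by
    rw [← integral_GA02, ← intervalIntegral.integral_const_mul]
    refine intervalIntegral.integral_congr fun s hs => ?_
    rw [uIcc_of_le (by linarith)] at hs
    simp only [gInt]
    rw [ramp_of_ge hs.1, mul_one, abs_of_nonpos (by linarith [hs.1]), neg_sub, ← integrand_cS3]
  rw [e1, e2]; ring

/-- Kind A (`67/20 ≤ r ≤ 77/20`): `∫_{67/20}^{r+8/5} gInt r = (6M)⁻¹ (GA1 + GA2 + GA3)(r)`. [folklore] -/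
theorem window_A {r : ℝ} (h1 : 67 / 20 ≤ r) (h2 : r ≤ 77 / 20) :
    ∫ s in (67 / 20 : ℝ)..(r + 8 / 5), gInt r s = (6 * tailConst)⁻¹ * (GA1 r + GA2 r + GA3 r) := by
  have hc := continuous_gInt r
  rw [← intervalIntegral.integral_add_adjacent_intervals (hc.intervalIntegrable (67 / 20) r) (hc.intervalIntegrable r (r + 8 / 5)),
    ← intervalIntegral.integral_add_adjacent_intervals (hc.intervalIntegrable r (77 / 20)) (hc.intervalIntegrable (77 / 20) (r + 8 / 5))]
  have e1 : ∫ s in (67 / 20 : ℝ)..r, gInt r s = (6 * tailConst)⁻¹ * GA1 r := by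
    rw [← integral_GA1, ← intervalIntegral.integral_const_mul]
    refine intervalIntegral.integral_congr fun s hs => ?_
    rw [uIcc_of_le h1] at hs
    simp only [gInt]
    rw [ramp_of_mem hs.1 (by linarith [hs.2]), abs_of_nonneg (by linarith [hs.2]), ← integrand_cS1]
  have e2 : ∫ s in r..(77 / 20 : ℝ), gInt r s = (6 * tailConst)⁻¹ * GA2 r := by
    rw [← integral_GA2, ← intervalIntegral.integral_const_mul]
    refine intervalIntegral.integral_congr fun s hs => ?_
    rw [uIcc_of_le h2] at hs
    simp only [gInt]
    rw [ramp_of_mem (by linarith [hs.1]) hs.2, abs_of_nonpos (by linarith [hs.1]), neg_sub, ← integrand_cS4]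
  have e3 : ∫ s in (77 / 20 : ℝ)..(r + 8 / 5), gInt r s = (6 * tailConst)⁻¹ * GA3 r := by
    rw [← integral_GA3, ← intervalIntegral.integral_const_mul]
    refine intervalIntegral.integral_congr fun s hs => ?_
    rw [uIcc_of_le (by linarith)] at hs
    simp only [gInt]
    rw [ramp_of_ge hs.1, mul_one, abs_of_nonpos (by linarith [hs.1]), neg_sub, ← integrand_cS3]
  rw [e1, e2, e3]; ring

/-- Kind B (`77/20 ≤ r`; used for `r ≤ 99/20`): `∫_{67/20}^{r+8/5} gInt r = (6M)⁻¹ (GB1 + GB2 + GB3)(r)`. [folklore] -/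
theorem window_B {r : ℝ} (h1 : 77 / 20 ≤ r) :
    ∫ s in (67 / 20 : ℝ)..(r + 8 / 5), gInt r s = (6 * tailConst)⁻¹ * (GB1 r + GB2 r + GB3 r) := by
  have hc := continuous_gInt r
  rw [← intervalIntegral.integral_add_adjacent_intervals (hc.intervalIntegrable (67 / 20) r) (hc.intervalIntegrable r (r + 8 / 5)),
    ← intervalIntegral.integral_add_adjacent_intervals (hc.intervalIntegrable (67 / 20) (77 / 20)) (hc.intervalIntegrable (77 / 20) r)]
  have e1 : ∫ s in (67 / 20 : ℝ)..(77 / 20), gInt r s = (6 * tailConst)⁻¹ * GB1 r := by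
    rw [← integral_GB1, ← intervalIntegral.integral_const_mul]
    refine intervalIntegral.integral_congr fun s hs => ?_
    rw [uIcc_of_le (by norm_num)] at hs
    simp only [gInt]
    rw [ramp_of_mem hs.1 hs.2, abs_of_nonneg (by linarith [hs.2]), ← integrand_cS1]
  have e2 : ∫ s in (77 / 20 : ℝ)..r, gInt r s = (6 * tailConst)⁻¹ * GB2 r := by
    rw [← integral_GB2, ← intervalIntegral.integral_const_mul]
    refine intervalIntegral.integral_congr fun s hs => ?_
    rw [uIcc_of_le h1] at hs
    simp only [gInt]
    rw [ramp_of_ge hs.1, mul_one, abs_of_nonneg (by linarith [hs.2]), ← integrand_cS2]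
  have e3 : ∫ s in r..(r + 8 / 5), gInt r s = (6 * tailConst)⁻¹ * GB3 r := by
    rw [← integral_GB3, ← intervalIntegral.integral_const_mul]
    refine intervalIntegral.integral_congr fun s hs => ?_
    rw [uIcc_of_le (by linarith)] at hs
    simp only [gInt]
    rw [ramp_of_ge (by linarith [hs.1]), mul_one, abs_of_nonpos (by linarith [hs.1]), neg_sub, ← integrand_cS3]
  rw [e1, e2, e3]; ring

/-- Kind C (`99/20 ≤ r ≤ 109/20`): `∫_{r−8/5}^{r+8/5} gInt r = (6M)⁻¹ (GC1 + GC2 + GC3)(r)`. [folklore] -/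
theorem window_C {r : ℝ} (h1 : 99 / 20 ≤ r) (h2 : r ≤ 109 / 20) :
    ∫ s in (r - 8 / 5)..(r + 8 / 5), gInt r s = (6 * tailConst)⁻¹ * (GC1 r + GC2 r + GC3 r) := by
  have hc := continuous_gInt r
  rw [← intervalIntegral.integral_add_adjacent_intervals (hc.intervalIntegrable (r - 8 / 5) r) (hc.intervalIntegrable r (r + 8 / 5)),
    ← intervalIntegral.integral_add_adjacent_intervals (hc.intervalIntegrable (r - 8 / 5) (77 / 20)) (hc.intervalIntegrable (77 / 20) r)]
  have e1 : ∫ s in (r - 8 / 5)..(77 / 20 : ℝ), gInt r s = (6 * tailConst)⁻¹ * GC1 r := by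
    rw [← integral_GC1, ← intervalIntegral.integral_const_mul]
    refine intervalIntegral.integral_congr fun s hs => ?_
    rw [uIcc_of_le (by linarith)] at hs
    simp only [gInt]
    rw [ramp_of_mem (by linarith [hs.1]) hs.2, abs_of_nonneg (by linarith [hs.2]), ← integrand_cS1]
  have e2 : ∫ s in (77 / 20 : ℝ)..r, gInt r s = (6 * tailConst)⁻¹ * GC2 r := by
    rw [← integral_GC2, ← intervalIntegral.integral_const_mul]
    refine intervalIntegral.integral_congr fun s hs => ?_
    rw [uIcc_of_le (by linarith)] at hs
    simp only [gInt]
    rw [ramp_of_ge hs.1, mul_one, abs_of_nonneg (by linarith [hs.2]), ← integrand_cS2]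
  have e3 : ∫ s in r..(r + 8 / 5), gInt r s = (6 * tailConst)⁻¹ * GC3 r := by
    rw [← integral_GC3, ← intervalIntegral.integral_const_mul]
    refine intervalIntegral.integral_congr fun s hs => ?_
    rw [uIcc_of_le (by linarith)] at hs
    simp only [gInt]
    rw [ramp_of_ge (by linarith [hs.1]), mul_one, abs_of_nonpos (by linarith [hs.1]), neg_sub, ← integrand_cS3]
  rw [e1, e2, e3]; ring

/-- The constant: `(4/5)³·(512π/3465)·(2π)·(6M)⁻¹ = K₀ = (11025/20790)/(4/5)³` (`π` cancels). [folklore] -/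
theorem const_identity : (4 / 5 : ℝ) ^ 3 * (512 * π / 3465) * (2 * π) * (6 * tailConst)⁻¹ = 11025 / 20790 / (4 / 5 : ℝ) ^ 3 := by
  unfold tailConst
  have hπ : π ≠ 0 := Real.pi_ne_zero
  field_simp
  ring

/-- **Secant bound by convexity**: for `0 < u ≤ r ≤ v`, `u < v`: `r⁻⁶ ≤ (u⁻⁶(v − r) + v⁻⁶(r − u))/(v − u)`. [folklore] -/
theorem inv_pow_six_le_secant {u v r : ℝ} (hu : 0 < u) (huv : u < v) (h1 : u ≤ r) (h2 : r ≤ v) :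
    (r⁻¹) ^ 6 ≤ ((u⁻¹) ^ 6 * (v - r) + (v⁻¹) ^ 6 * (r - u)) / (v - u) := by
  have hv : 0 < v := hu.trans huv
  have hw : 0 < v - u := by linarith
  set t : ℝ := (r - u) / (v - u) with ht
  have ht0 : 0 ≤ t := by rw [ht]; positivity
  have ht1 : t ≤ 1 := by rw [ht, div_le_one hw]; linarith
  have hconv := (convexOn_zpow (-6 : ℤ) : ConvexOn ℝ (Ioi (0:ℝ)) fun x : ℝ => x ^ (-6 : ℤ)).2 (mem_Ioi.2 hu) (mem_Ioi.2 hv)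
    (show (0:ℝ) ≤ 1 - t by linarith) ht0 (by ring)
  have hr : (1 - t) • u + t • v = r := by
    simp only [smul_eq_mul]; rw [ht]; field_simp; ring
  rw [hr] at hconv
  simp only [smul_eq_mul] at hconv
  have e : ∀ x : ℝ, 0 < x → x ^ (-6 : ℤ) = (x⁻¹) ^ 6 := fun x hx => by
    rw [show (-6 : ℤ) = -((6 : ℕ) : ℤ) by norm_num, zpow_neg, zpow_natCast, inv_pow]
  rw [e r (by linarith), e u hu, e v hv] at hconv
  refine hconv.trans (le_of_eq ?_)
  rw [ht]; field_simp; ring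

/-- From a certificate `r·sec(r)·w ≤ 6K₀·Gs` (with `w = w₄₅ r`, `sec` the secant of `r⁻⁶` on `[u, v] ∋ r`) and the window bound
`(6M)⁻¹·Gs ≤ ∫_{s>0} sInt r` to the near-field inequality at `r`. [folklore] -/
theorem near_of_cert {u v r Gs wv : ℝ} (hu : 0 < u) (huv : u < v) (h1 : u ≤ r) (h2 : r ≤ v) (hr : 3 < r) (hwv : w₄₅ r = wv)
    (hF : r * (((u⁻¹) ^ 6 * (v - r) + (v⁻¹) ^ 6 * (r - u)) / (v - u)) * wv ≤ 6 * (11025 / 20790 / (4 / 5 : ℝ) ^ 3) * Gs)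
    (hwin : (6 * tailConst)⁻¹ * Gs ≤ ∫ s in Ioi 0, sInt r s) :
    -(tailPot w₄₅ r) ≤ (4 / 5 : ℝ) ^ 3 * (512 * π / 3465) *
      (2 * π / r * ∫ s in Ioi 0, s * kappaL s * ∫ τ in |r - s|..(r + s), τ * omega₂ (τ / (4 / 5))) := by
  have hr0 : 0 < r := by linarith
  subst hwv
  have hI : ∫ s in Ioi 0, s * kappaL s * ∫ τ in |r - s|..(r + s), τ * omega₂ (τ / (4 / 5)) = ∫ s in Ioi 0, sInt r s := rfl
  rw [hI]
  have hw := w₄₅_mem_Icc r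
  -- step 1: −(V·w)(r) ≤ (r⁻¹)^6/6 · w
  have hL : -(tailPot w₄₅ r) ≤ (r⁻¹) ^ 6 / 6 * w₄₅ r := by
    unfold tailPot lennardJones
    have hy : 0 ≤ (r⁻¹) ^ 12 := by positivity
    nlinarith [hw.1, hw.2, hy, mul_nonneg hy hw.1]
  -- step 2: secant
  have hsec := inv_pow_six_le_secant hu huv h1 h2
  have hL2 : (r⁻¹) ^ 6 / 6 * w₄₅ r ≤ (((u⁻¹) ^ 6 * (v - r) + (v⁻¹) ^ 6 * (r - u)) / (v - u)) / 6 * w₄₅ r :=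
    mul_le_mul_of_nonneg_right (div_le_div_of_nonneg_right hsec (by norm_num)) hw.1
  -- step 3: certificate and window
  have hC : 0 ≤ (4 / 5 : ℝ) ^ 3 * (512 * π / 3465) * (2 * π / r) := by positivity
  have hK := const_identity
  calc -(tailPot w₄₅ r) ≤ (((u⁻¹) ^ 6 * (v - r) + (v⁻¹) ^ 6 * (r - u)) / (v - u)) / 6 * w₄₅ r := hL.trans hL2
    _ = (r * (((u⁻¹) ^ 6 * (v - r) + (v⁻¹) ^ 6 * (r - u)) / (v - u)) * w₄₅ r) / (6 * r) := by field_simp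
    _ ≤ (6 * (11025 / 20790 / (4 / 5 : ℝ) ^ 3) * Gs) / (6 * r) := div_le_div_of_nonneg_right hF (by positivity)
    _ = (4 / 5 : ℝ) ^ 3 * (512 * π / 3465) * (2 * π / r) * ((6 * tailConst)⁻¹ * Gs) := by
        rw [show (6 * tailConst)⁻¹ = 11025 / 20790 / (4 / 5 : ℝ) ^ 3 / ((4 / 5 : ℝ) ^ 3 * (512 * π / 3465) * (2 * π)) by
          rw [← hK]; field_simp]
        field_simp
    _ ≤ (4 / 5 : ℝ) ^ 3 * (512 * π / 3465) * (2 * π / r) * ∫ s in Ioi 0, sInt r s := mul_le_mul_of_nonneg_left hwin hC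
    _ = _ := by ring

/-- ★★★ **`SF₄₅` HOLDS** — lens-5 g34's Schur tail floor at range 9/2, `SchurFloor w₄₅ ω₄ (3/400)`: for EVERY finite configuration of points in `ℝ³`,
`−(3/400)·(N + 2·Σ_{i<j} ω₄(r_ij)) ≤ Σ_{i<j} (V·w₄₅)(r_ij)`. [folklore: Schur test + certified elementary one-variable inequality] -/
theorem sf₄₅_holds : SF₄₅ := by
  refine sf₄₅_of_nearIneq fun r hr1 hr2 => ?_
  have hr3 : 3 ≤ r := hr1.le
  -- window bounds per kind
  have winA0 : r ≤ 67 / 20 → (6 * tailConst)⁻¹ * (GA01 r + GA02 r) ≤ ∫ s in Ioi 0, sInt r s := fun h => by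
    rw [← window_A0 hr3 h]; exact window_le_integral hr3 le_rfl (by linarith) (by linarith) (by linarith)
  have winA : 67 / 20 ≤ r → r ≤ 77 / 20 → (6 * tailConst)⁻¹ * (GA1 r + GA2 r + GA3 r) ≤ ∫ s in Ioi 0, sInt r s := fun h h' => by
    rw [← window_A h h']; exact window_le_integral hr3 le_rfl (by linarith) (by linarith) (by linarith)
  have winB : 77 / 20 ≤ r → r ≤ 99 / 20 → (6 * tailConst)⁻¹ * (GB1 r + GB2 r + GB3 r) ≤ ∫ s in Ioi 0, sInt r s := fun h h' => by
    rw [← window_B h]; exact window_le_integral hr3 le_rfl (by linarith) (by linarith) (by linarith)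
  have winC : 99 / 20 ≤ r → r ≤ 109 / 20 → (6 * tailConst)⁻¹ * (GC1 r + GC2 r + GC3 r) ≤ ∫ s in Ioi 0, sInt r s := fun h h' => by
    rw [← window_C h h']; exact window_le_integral hr3 (by linarith) le_rfl (by linarith) (by linarith)
  rcases le_or_gt r (67 / 20) with c1 | c1
  · exact near_of_cert (by norm_num) (by norm_num) hr3 c1 hr1 (w₄₅_eq_cubic hr3 (by linarith)) (cert1 hr3 c1) (winA0 c1)
  rcases le_or_gt r (18 / 5) with c2 | c2
  · exact near_of_cert (by norm_num) (by norm_num) c1.le c2 hr1 (w₄₅_eq_cubic hr3 (by linarith)) (cert2 c1.le c2) (winA c1.le (by linarith))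
  rcases le_or_gt r (77 / 20) with c3 | c3
  · exact near_of_cert (by norm_num) (by norm_num) c2.le c3 hr1 (w₄₅_eq_cubic hr3 (by linarith)) (cert3 c2.le c3) (winA (by linarith) c3)
  rcases le_or_gt r (167 / 40) with c4 | c4
  · exact near_of_cert (by norm_num) (by norm_num) c3.le c4 hr1 (w₄₅_eq_cubic hr3 (by linarith)) (cert4 c3.le c4) (winB c3.le (by linarith))
  rcases le_or_gt r (9 / 2) with c5 | c5
  · exact near_of_cert (by norm_num) (by norm_num) c4.le c5 hr1 (w₄₅_eq_cubic hr3 c5) (cert5 c4.le c5) (winB (by linarith) (by linarith))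
  rcases le_or_gt r (99 / 20) with c6 | c6
  · exact near_of_cert (by norm_num) (by norm_num) c5.le c6 hr1 (w₄₅_eq_one c5.le) (cert6 c5.le c6) (winB (by linarith) c6)
  · exact near_of_cert (by norm_num) (by norm_num) c6.le hr2 hr1 (w₄₅_eq_one (by linarith)) (cert7 c6.le hr2) (winC c6.le hr2)

end Summit.AtomisticToContinuum.Crystallization.Theorems.FrustratedLawDichotomyBumpAutocorrelation

end
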